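import Literature.AlgebraicGeometry.HodgeTheory.MonomialSupportedHypersurfaceNoInvariants
import Literature.AlgebraicGeometry.HodgeTheory.BettiUniverseAxioms
import HarnessLib

/-!
# K1-B piece NOINV of crux `VeryGeneralSignCommutatorsInHg` (route `SignSymmetricPowers`, item
# stmt-HodgeConjecture-19716): no monodromy invariants on `H³` — `stub_signNoInvariants` BY NAME

Line `andre-zariski`, skeleton v12e (`f94dc4e163f9499d`; NOINV text byte-identical since v12c), registered stub
`stub_signNoInvariants`, landed `--supports stmt-HodgeConjecture-19716` (closes the stub, not the item).

GRANTED Deligne's global invariant cycle theorem (the named fact `deligne_globalInvariantCycles`, the stub's own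
antecedent), for every even `d ≥ 4` and EVERY member `𝒴_t` of the family `familyM ℂ 3 d M` of smooth degree-`d`
threefolds in `ℙ⁴` supported on the ι-even monomials `M = {m | m₀ + m₁ even}`, the rational monodromy group `Γ = ratMonodromyGroup (familyM ℂ 3 d M) 3 _ t` has no
non-zero invariant in `H³(𝒴_t; ℚ)`.

The whole proof is the Literature theorem
`Literature.AlgebraicGeometry.HodgeTheory.UniversalHypersurface.familyM_ratInvariant_eq_zero_of_odd`
(littype-FH1-2, `MonomialSupportedHypersurfaceNoInvariants`: Voisin II Thm. 4.24 / Cor. 4.25 for the smooth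
compactifiable incidence variety `W_M ⊇ 𝒴_M` with `H^{odd}(W_M) = 0`), specialised to `n = 3`, `k = 3` and the parity
system, which is base-point free for even `d` (`isBasePointFree_setOf_even_add`).  This file only unpacks the
registered binder text (its `let`s are introduced as local definitions).

Sorry-free; axioms `propext`, `Classical.choice`, `Quot.sound`; no definition, no named fact beyond the stub's own
antecedent F-GIC.

## References

* [VoisinHodgeII2003] C. Voisin, Hodge Theory and Complex Algebraic Geometry II (CUP 2003), Thm. 4.24, Cor. 4.25,
  §6.2.1.
* [DeligneHodgeII1971] P. Deligne, Théorie de Hodge II, Publ. Math. IHÉS 40 (1971), Thm. 4.1.1.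
-/

noncomputable section

set_option linter.dupNamespace false

open CategoryTheory AlgebraicGeometry
open Literature.AlgebraicTopology.SingularHomology
open Literature.AlgebraicGeometry.Motives Literature.AlgebraicGeometry.Motives.UniversalHypersurface
open Literature.AlgebraicGeometry.HodgeTheory Literature.AlgebraicGeometry.HodgeTheory.UniversalHypersurface
open Literature.AlgebraicGeometry.HodgeTheory.BettiUniverse

namespace Summit.HodgeConjecture.HodgeConjecture.Theorems.SignSymmetricPowersNoInvariants

/-- **`stub_signNoInvariants`** (registered stub NOINV of the K1-B line `andre-zariski`, skeleton v12e
`f94dc4e163f9499d`, signature verbatim): granted `deligne_globalInvariantCycles`, for every even `d ≥ 4` and every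
complex point `t` of the base `S_M` of the ι-even family `familyM ℂ 3 d M` (`M = {m | m₀ + m₁ even}`), every class
`x ∈ H³(𝒴_t; ℚ)` fixed by the whole rational monodromy group `Γ_t` is zero.  Proof: `k = 3` is odd and `M` is
base-point free, so `familyM_ratInvariant_eq_zero_of_odd` applies.
[cite: VoisinHodgeII2003, Thm. 4.24 and Cor. 4.25] [cite: DeligneHodgeII1971, Théorème 4.1.1] -/
theorem stub_signNoInvariants :
    open Literature.AlgebraicGeometry.Motives Literature.AlgebraicGeometry.Motives.UniversalHypersurface Literature.AlgebraicGeometry.HodgeTheory Literature.AlgebraicGeometry.HodgeTheory.UniversalHypersurface Literature.AlgebraicGeometry.HodgeTheory.BettiUniverse CategoryTheory.Limits in deligne_globalInvariantCycles → ∀ ⦃d : ℕ⦄, Even d → ∀ (h4 : 4 ≤ d), (let M : Set (DegIndex 3 d) := {m | Even (m.1 0 + m.1 1)}; let u := familyM ℂ 3 d M; let hu : IsSmoothProjectiveFamily u 3 := isSmoothProjectiveFamily_familyM ℂ 3 d M (by decide) (le_trans (by decide) h4); let hU : IsCohomologicallyLocallyTrivialOn u (Set.univ : Set (ComplexPoints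 (baseM ℂ 3 d M))) := isCohomologicallyLocallyTrivialOn_familyM 3 d M (by decide) (le_trans (by decide) h4); ∀ (t : ComplexPoints (baseM ℂ 3 d M)), let Y := fiberOver u t; let hY : IsSmoothProjective 3 Y := hu.isSmoothProjective t; let Γ := (haveI := finite hY 3; ratMonodromyGroup u 3 hU ⟨t, Set.mem_univ _⟩); ∀ x : bettiCohomology Y 3, (∀ g ∈ Γ, g x = x) → x = 0) := by
  intro hGIC d hev h4 M u hu hU t Y hY Γ x hx
  exact familyM_ratInvariant_eq_zero_of_odd (n := 3) (k := 3) hGIC (isBasePointFree_setOf_even_add (n := 3) hev)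
    (by decide) (le_trans (by decide) h4) (by decide) hU t x hx

end Summit.HodgeConjecture.HodgeConjecture.Theorems.SignSymmetricPowersNoInvariants
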